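import Literature.NumberTheory.Automorphic.ArtinLFunctionsRankOneMatching
import HarnessLib

/-!
# The primitive ray class datum of a character of degree one, with its values at the unramified primes

Topic `Literature/NumberTheory/Automorphic`; namespace `Literature.NumberTheory.Automorphic`.  Pure-proof
companion of `ArtinLFunctionsRankOnePrimitive.lean` (`exists_primitive_rayClass_datum`) and
`ArtinLFunctionsRankOneMatching.lean` (`IsAdmissibleDatum`, `matching_of_isAdmissibleDatum`).

> **Neukirch VII (10.6) and its Remark (p. 526).** For an abelian extension `L|K` with conductor `𝔣` and a
> character `χ` of `G(L|K)`, "one has complete equality `𝓛(L|K, χ, s) = L(χ̃, s)`", where `χ̃ = χ ∘ (L|K/·)`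
> is "a *primitive* Größencharakter `mod 𝔣`"; proof of (10.6): "for `𝔭 ∤ 𝔣`, one has `(L|K/𝔭) = φ_𝔓`, and so
> `χ̃(𝔭) = χ(φ_𝔓)`".

`exists_primitive_rayClass_datum` records the primitive datum `(𝔣, χ, p)` of `ψ : Γ_K → GL_1(ℂ)` only through
the identities `L(s, ψ) = L(χ, s)`, `L(s, ψ^∨) = L(χ̄, s)`; the VALUES `χ(𝔭) = det ψ(φ_𝔓)` at the primes `𝔭`
unramified for `ψ` (the second half of Neukirch's dictionary) are lost in its statement, and cannot be
recovered from the L-series (primes of equal norm are aggregated).  This file re-runs the same proof and keeps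
them:

* `exists_isAdmissibleDatum_with_values` — for every `ψ : Γ_K → GL_1(ℂ)` there is an admissible primitive
  datum `(𝔣, χ, p)` (`IsAdmissibleDatum ψ 𝔣 χ p`) such that `𝔣` is supported on primes ramified for `ψ`
  and `χ(v) = det ψ(σ)` for every prime `v` unramified for `ψ`, every prime `𝔓 ∣ v` of `\bar ℤ_K` and every
  arithmetic Frobenius `σ ∈ Γ_K` at `𝔓`;
* `artinConductorNorm_eq_of_values` — consequently `A(ψ) = |d_K| · 𝔑𝔣` for THIS datum
  (`matching_of_isAdmissibleDatum`).

These are the inputs for the Hecke factorisation of the Dedekind zeta function of a cyclic extension with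
primitive characters and the conductor–discriminant formula (`ArtinLFunctionsCyclicHeckeFactorisation.lean`).
Deviation from the printed proof as in `ArtinLFunctionsRankOnePrimitive.lean`: the absence of missing Euler
factors is proved analytically (`dedekindZetaCont_ne_zero_of_re_eq_zero`), not by VI (6.6).

## References

* J. Neukirch, *Algebraic Number Theory*, Springer 1999, Ch. VII §10 Thm. (10.6), its proof and Remark;
  §6 p. 472; Ch. VI §6 Cor. (6.6). [NeukirchANT1999]
-/

noncomputable section

open scoped NumberField
open Field IsDedekindDomain NumberField NumberField.InfinitePlace Filter Complex
open Literature.NumberTheory.GaloisRepresentations Literature.NumberTheory.LFunctions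

universe u

namespace Literature.NumberTheory.Automorphic

variable {K : Type u} [Field K] [NumberField K]

/-- **The primitive ray class datum of a character of degree one, with values** (Neukirch VII (10.6), proof
and Remark: `χ̃(𝔭) = χ(φ_𝔓)` for `𝔭 ∤ 𝔣`, "complete equality `𝓛(L|K, χ, s) = L(χ̃, s)`", `χ̃` primitive
`mod 𝔣`).  For every `ψ : Γ_K → GL_1(ℂ)` there are `𝔣 ≠ 0`, a primitive ray class character `χ mod 𝔣` of sign
type `p` forming an admissible datum of `ψ` (`L(s, ψ) = L(χ, s)`, `L(s, ψ^∨) = L(χ̄, s)`), such that every prime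
dividing `𝔣` is ramified for `ψ`, and `χ(v) = det ψ(σ)` for every `v` unramified for `ψ`, every prime `𝔓 ∣ v`
of `\bar ℤ_K` and every arithmetic Frobenius `σ` at `𝔓`.
[cite: NeukirchANT1999, Ch. VII §10 Thm. (10.6) (proof and Remark); Ch. VII §6 p. 472] -/
theorem exists_isAdmissibleDatum_with_values (ψ : FramedArtinRep K 1) :
    ∃ (𝔣 : Ideal (𝓞 K)) (χ : HeightOneSpectrum (𝓞 K) → ℂ) (p : Finset {w : InfinitePlace K // w.IsReal}),
      IsAdmissibleDatum ψ 𝔣 χ p ∧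
      (∀ v : HeightOneSpectrum (𝓞 K), 𝔣 ≤ v.asIdeal → ¬ GaloisRep.IsUnramifiedAt v ψ.toArtinRep) ∧
      (∀ v : HeightOneSpectrum (𝓞 K), GaloisRep.IsUnramifiedAt v ψ.toArtinRep →
        ∀ 𝔓 ∈ v.primesAbove, ∀ σ : absoluteGaloisGroup K, IsArithFrobAt (𝓞 K) σ 𝔓 →
          χ v = (FramedRep.det ψ σ : ℂ)) := by
  classical
  -- the reciprocity datum `(𝔪, χ̃)` and its dual
  obtain ⟨𝔪, h𝔪, χ, hχ, hunr, hram⟩ := artinReciprocity_rankOne_holds K ψ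
  have hL : ∀ s : ℂ, 1 < s.re → artinLFunction ψ.toArtinRep s = rayClassLSeries 𝔪 χ s := fun s hs ↦
    artinLFunction_eq_rayClassLSeries ψ h𝔪 hχ hunr hram hs
  have hunr' : ∀ v : HeightOneSpectrum (𝓞 K), ¬ 𝔪 ≤ v.asIdeal →
      GaloisRep.IsUnramifiedAt v (FramedArtinRep.toArtinRep (FramedRep.dual ψ)) ∧
        ∀ 𝔓 ∈ v.primesAbove, ∀ σ : absoluteGaloisGroup K, IsArithFrobAt (𝓞 K) σ 𝔓 →
          (star χ) v = (FramedRep.det (FramedRep.dual ψ) σ : ℂ) := by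
    intro v hv
    obtain ⟨hur, hval⟩ := hunr v hv
    refine ⟨(FramedGaloisRep.isUnramifiedAt_toGaloisRep_iff v _).mpr
      ((FramedGaloisRep.isUnramifiedAt_dual_iff v ψ).mpr ((FramedGaloisRep.isUnramifiedAt_toGaloisRep_iff v ψ).mp hur)),
      fun 𝔓 h𝔓 σ hσ ↦ ?_⟩
    have h1 : ‖χ v‖ = 1 := hχ.norm_eq_one v hv
    rw [Pi.star_apply, det_dual_apply, Units.val_inv_eq_inv_val, ← hval 𝔓 h𝔓 σ hσ, Complex.inv_eq_conj h1]
    rfl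
  have hram' : ∀ v : HeightOneSpectrum (𝓞 K), 𝔪 ≤ v.asIdeal →
      ¬ GaloisRep.IsUnramifiedAt v (FramedArtinRep.toArtinRep (FramedRep.dual ψ)) := fun v hv h ↦
    hram v hv ((FramedGaloisRep.isUnramifiedAt_toGaloisRep_iff v ψ).mpr
      ((FramedGaloisRep.isUnramifiedAt_dual_iff v ψ).mp ((FramedGaloisRep.isUnramifiedAt_toGaloisRep_iff v _).mp h)))
  have hL' : ∀ s : ℂ, 1 < s.re →
      artinLFunction (FramedArtinRep.toArtinRep (FramedRep.dual ψ)) s = rayClassLSeries 𝔪 (star χ) s := fun s hs ↦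
    artinLFunction_eq_rayClassLSeries (FramedRep.dual ψ) h𝔪 hχ.star hunr' hram' hs
  -- the primitive associate `(𝔣, χ₀)` of `(𝔪, χ̃)`
  obtain ⟨p, hp⟩ := hχ.exists_isSignType h𝔪
  obtain ⟨𝔣, hD, hmax⟩ := exists_conductor hp h𝔪
  obtain ⟨𝔟, h𝔟⟩ := exists_isTransportData h𝔪 hD.le
  set χ₀ := transportChar K χ 𝔣 𝔟 with hχ₀def
  have h𝔣0 : 𝔣 ≠ ⊥ := fun h ↦ h𝔪 (le_bot_iff.mp (h ▸ hD.le))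
  have hχ₀ : IsRayClassCharacter 𝔣 χ₀ := isRayClassCharacter_transportChar hχ hp h𝔪 hD h𝔟
  have hprim : IsPrimitive 𝔣 χ₀ := isPrimitive_transportChar hχ hp h𝔪 hD hmax h𝔟
  have hsign : IsSignType 𝔣 χ₀ p := isSignType_transportChar hχ hp h𝔪 hD h𝔟
  -- the two new clauses: support of `𝔣`, and the values off `𝔪`
  have hsupp : ∀ v : HeightOneSpectrum (𝓞 K), 𝔣 ≤ v.asIdeal → ¬ GaloisRep.IsUnramifiedAt v ψ.toArtinRep :=
    fun v hv ↦ hram v (hD.le.trans hv)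
  have hvals : ∀ v : HeightOneSpectrum (𝓞 K), GaloisRep.IsUnramifiedAt v ψ.toArtinRep →
      ∀ 𝔓 ∈ v.primesAbove, ∀ σ : absoluteGaloisGroup K, IsArithFrobAt (𝓞 K) σ 𝔓 →
        χ₀ v = (FramedRep.det ψ σ : ℂ) := by
    intro v hv 𝔓 h𝔓 σ hσ
    have hvm : ¬ 𝔪 ≤ v.asIdeal := fun h ↦ hram v h hv
    rw [hχ₀def, transportChar_eq hχ hp h𝔪 hD h𝔟 hvm]
    exact (hunr v hvm).2 𝔓 h𝔓 σ hσ
  set T : Finset (HeightOneSpectrum (𝓞 K)) :=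
    (Ideal.finite_factors h𝔪).toFinset.filter (fun v ↦ ¬ 𝔣 ≤ v.asIdeal) with hT
  have hmemT : ∀ v, v ∈ T ↔ 𝔪 ≤ v.asIdeal ∧ ¬ 𝔣 ≤ v.asIdeal := fun v ↦ by
    rw [hT, Finset.mem_filter, Set.Finite.mem_toFinset, Set.mem_setOf_eq, Ideal.dvd_iff_le]
  set P : ℂ → ℂ := fun s ↦ ∏ v ∈ T, (1 - χ₀ v * ((Ideal.absNorm v.asIdeal : ℕ) : ℂ) ^ (-s)) with hPdef
  have hE : ∀ s : ℂ, 1 < s.re → rayClassLSeries 𝔪 χ s = rayClassLSeries 𝔣 χ₀ s * P s := fun s hs ↦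
    rayClassLSeries_eq_mul_prod_transportChar hχ hp h𝔪 hD h𝔟 hs
  have hE' : ∀ s : ℂ, 1 < s.re → rayClassLSeries 𝔪 (star χ) s = rayClassLSeries 𝔣 (star χ₀) s *
      ∏ v ∈ T, (1 - (star χ₀) v * ((Ideal.absNorm v.asIdeal : ℕ) : ℂ) ^ (-s)) := fun s hs ↦ by
    have := rayClassLSeries_eq_mul_prod_transportChar hχ.star hp.star h𝔪 hD.star h𝔟 hs
    rwa [transportChar_star] at this
  -- it suffices that no Euler factor is missing
  suffices hTe : T = ∅ by
    refine ⟨𝔣, χ₀, p, ⟨h𝔣0, hχ₀, hprim, hsign, fun s hs ↦ ?_, fun s hs ↦ ?_⟩, hsupp, hvals⟩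
    · rw [hL s hs, hE s hs, hPdef]
      simp only [hTe, Finset.prod_empty, mul_one]
    · rw [hL' s hs, hE' s hs, hTe, Finset.prod_empty, mul_one]
  by_contra hne
  obtain ⟨v₀, hv₀⟩ := Finset.nonempty_iff_ne_empty.mpr hne
  obtain ⟨hv₀m, hv₀f⟩ := (hmemT v₀).mp hv₀
  -- (1) `ψ` is non-trivial (it ramifies at `v₀ ∣ 𝔪`)
  have hψnt : ∃ γ, FramedRep.det ψ γ ≠ 1 := by
    by_contra hall
    push Not at hall
    exact hram v₀ hv₀m ((FramedGaloisRep.isUnramifiedAt_toGaloisRep_iff v₀ ψ).mpr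
      fun 𝔓 _ σ _ ↦ (det_eq_one_iff_rankOne ψ σ).mp (hall σ))
  -- (2) `P` is entire
  have hPd : Differentiable ℂ P := by
    have hq : ∀ v : HeightOneSpectrum (𝓞 K), ((Ideal.absNorm v.asIdeal : ℕ) : ℂ) ≠ 0 := fun v ↦
      Nat.cast_ne_zero.mpr (by have := HeightOneSpectrum.one_lt_absNorm v; omega)
    refine Differentiable.fun_finsetProd fun v _ ↦ ?_
    exact (differentiable_const _).fun_sub ((differentiable_const _).fun_mul
      (differentiable_id.fun_neg.const_cpow (Or.inl (hq v))))
  -- (3) continuations: `G` of `L(χ₀, s)`, `F j` of `L(s, ψ^j)`, and `ζ_M = ∏ F j`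
  obtain ⟨G, -, hGd, hGs⟩ := rayClassLSeries_hasMeromorphicContinuation_holds (K := K) 𝔣 h𝔣0 χ₀ hχ₀
  obtain ⟨Ψ, hΨ1, -, M, _, _, n, h1n, hζ⟩ := exists_dedekindZeta_eq_prod_artinLFunction_pow ψ hψnt
  have hF := fun j : ℕ ↦ exists_differentiableOn_eq_artinLFunction_rankOne (Ψ j)
  choose F hFd hFs using hF
  -- (4) the identity theorem, twice
  have hU : ({0, 1}ᶜ : Set ℂ) ⊆ ({1}ᶜ : Set ℂ) := Set.compl_subset_compl.mpr (Set.subset_insert _ _)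
  have hζd : DifferentiableOn ℂ (dedekindZetaCont M) ({0, 1}ᶜ : Set ℂ) :=
    (NumberField.isDedekindZetaContinuation_dedekindZetaCont_holds M).differentiableOn.mono hU
  have hprod : Set.EqOn (dedekindZetaCont M) (fun s ↦ ∏ j ∈ Finset.range n, F j s) ({0, 1}ᶜ : Set ℂ) := by
    refine eqOn_compl_zero_one_of_eqOn_one_lt_re hζd (DifferentiableOn.fun_finsetProd fun j _ ↦ hFd j) fun s hs ↦ ?_
    rw [(NumberField.isDedekindZetaContinuation_dedekindZetaCont_holds M).eqOn hs, hζ s hs]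
    exact Finset.prod_congr rfl fun j _ ↦ (hFs j s hs).symm
  have hone : Set.EqOn (F 1) (G * P) ({0, 1}ᶜ : Set ℂ) := by
    refine eqOn_compl_zero_one_of_eqOn_one_lt_re (hFd 1) (hGd.mul hPd.differentiableOn) fun s hs ↦ ?_
    rw [hFs 1 s hs, hΨ1, hL s hs, hE s hs, Pi.mul_apply, hGs s hs]
  -- (5) the zero `s₀ = it₀` of the missing Euler factor at `v₀`
  obtain ⟨s₀, hre, him, hv₀0⟩ := exists_one_sub_mul_cpow_neg_eq_zero (hχ₀.norm_eq_one v₀ hv₀f)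
    (HeightOneSpectrum.one_lt_absNorm v₀)
  have hs₀U : s₀ ∈ ({0, 1}ᶜ : Set ℂ) := by
    simp only [Set.mem_compl_iff, Set.mem_insert_iff, Set.mem_singleton_iff, not_or]
    exact ⟨fun h ↦ him (by rw [h]; simp), fun h ↦ him (by rw [h]; simp)⟩
  have hP0 : P s₀ = 0 := Finset.prod_eq_zero hv₀ hv₀0
  -- (6) `ζ_M(s₀) = 0`: contradiction
  have hζ0 : dedekindZetaCont M s₀ = 0 := by
    rw [hprod hs₀U]
    show ∏ j ∈ Finset.range n, F j s₀ = 0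
    refine Finset.prod_eq_zero (Finset.mem_range.mpr h1n) ?_
    rw [hone hs₀U, Pi.mul_apply, hP0, mul_zero]
  exact dedekindZetaCont_ne_zero_of_re_eq_zero M hre him hζ0

/-- **The conductor–discriminant matching for the valued datum**: with `(𝔣, χ, p)` as in
`exists_isAdmissibleDatum_with_values` and `(det ψ)^n = 1`, the Artin conductor norm of `ψ` is
`A(ψ) = |d_K| · 𝔑𝔣` and `n⁺(ψ) = r₁ - |p|` (`matching_of_isAdmissibleDatum`).
[cite: NeukirchANT1999, Ch. VII §11 (11.10); §12 p. 540] -/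
theorem exists_isAdmissibleDatum_with_values_and_matching (ψ : FramedArtinRep K 1) {n : ℕ} (hn : 0 < n)
    (hpow : ∀ γ : absoluteGaloisGroup K, FramedRep.det ψ γ ^ n = 1) :
    ∃ (𝔣 : Ideal (𝓞 K)) (χ : HeightOneSpectrum (𝓞 K) → ℂ) (p : Finset {w : InfinitePlace K // w.IsReal}),
      IsAdmissibleDatum ψ 𝔣 χ p ∧
      (∀ v : HeightOneSpectrum (𝓞 K), 𝔣 ≤ v.asIdeal → ¬ GaloisRep.IsUnramifiedAt v ψ.toArtinRep) ∧
      (∀ v : HeightOneSpectrum (𝓞 K), GaloisRep.IsUnramifiedAt v ψ.toArtinRep →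
        ∀ 𝔓 ∈ v.primesAbove, ∀ σ : absoluteGaloisGroup K, IsArithFrobAt (𝓞 K) σ 𝔓 →
          χ v = (FramedRep.det ψ σ : ℂ)) ∧
      sigPlus ψ.toArtinRep = nrRealPlaces K - p.card ∧
      ψ.toArtinRep.artinConductorNorm = (NumberField.discr K).natAbs * Ideal.absNorm 𝔣 := by
  obtain ⟨𝔣, χ, p, hD, hsupp, hvals⟩ := exists_isAdmissibleDatum_with_values ψ
  obtain ⟨hsig, hA⟩ := matching_of_isAdmissibleDatum n hn ψ hpow 𝔣 χ p hD
  exact ⟨𝔣, χ, p, hD, hsupp, hvals, hsig, hA⟩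

end Literature.NumberTheory.Automorphic
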